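import Summits.QuantumFields.YangMills.Theorems.FradkinShenkerFlowSusceptibilityToPoincareFineClauseMono

/-!
# Rider `stub_levelMarginal` (N2) of the line `rg-variance-cascade` (crux `SusceptibilityToPoincare`)

Route `FradkinShenkerFlow` of `YangMills`, crux item `stmt-QuantumFields-9441`
(`Summit.QuantumFields.YangMills.Theses.FradkinShenkerFlow.SusceptibilityToPoincare`, FS ⇒ UP),
registered skeleton `Cruxes/SusceptibilityToPoincare/Lines/rg_variance_cascade.lean`, rider N2 of
the necessity package "UP ⇒ TerminalPoincare": **the (fine field, level-`k` block field) marginal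
of the `n`-level joint law is the one-level joint law at block size `b^(k+1)`.**

For the 4D torus of side `2S+1`, the Wilson measure `μ = wilsonMeasure r.ρ β`, a block base
`b ≥ 1`, `n` levels and a pin strength `s`, the `n`-level joint law of the fine field `U` and its
von Mises–Fisher-smeared straight-transporter block fields `V = (V^k)_{k<n}` is

  `P = (μ ⊗ ⊗_k Haar^{⊗E_k}).tilted (Σ_k Σ_e s · Re tr r.ρ (V^k_e · h_{k,e}(U)⁻¹))`,
  `h_{k,e}(U) = BalabanAveraging.link (2S+1) b^(k+1) (BlockMean.rep 0) U e`,

and we prove, for every level `k < n`,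

  `P.map ((U, V) ↦ (U, V^k)) = (μ ⊗ Haar^{⊗E_k}).tilted (Σ_e s · Re tr r.ρ (V_e · h_{k,e}(U)⁻¹))`.

## Proof

Instance of the compatible-shears lemma `FineClauseMono.map_prodMap_tilted_prod_shear` with
`μ` the Wilson measure (a probability measure, `isProbabilityMeasure_wilsonMeasure`), `π` the
`n`-level and `π'` the level-`k` product Haar measure, `g` the `n`-level shear
`V^j_e ↦ V^j_e · h_{j,e}(U)⁻¹` (`JointMarginal.measurable_shear`, `JointMarginal.map_shear_pi`),
`g'` the one-level shear at block size `b^(k+1)` (`LevelMarginal.measurable_oneLevelShear`,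
`LevelMarginal.map_oneLevelShear_pi`: right invariance of Haar) with left inverse the one-level
unshear (`LevelMarginal.measurable_oneLevelUnshear`, `inv_mul_cancel_right`), the projection
`p = Function.eval k` (so that `id × p = (U, V) ↦ (U, V^k)` and `p ∘ g U = g' U ∘ p`
definitionally), the level sum `ψ(V) = Σ_j Σ_e s · Re tr r.ρ (V^j_e)`
(`JointMarginal.measurable_levelSum`) and the measurable one-link sum
`ψ'(W) = Σ_e s · Re tr r.ρ (W_e)` (`continuous_trace_re`); the remaining input, the level-`k`
marginal of the product of Haar measures tilted by the level sum,
`(π.tilted ψ).map (eval k) = π'.tilted ψ'`, is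
`FineClauseMono.map_eval_pi_tilted_sum` (write `n = m + 1`, possible since `k : Fin n`; the
summands are bounded above by `Σ_e |s| · sup |Re tr r.ρ|`, `exists_bound_trace_re_nonneg`).
-/

noncomputable section

open MeasureTheory ProbabilityTheory
open Literature.MathematicalPhysics.QuantumFieldTheory

namespace Summit.QuantumFields.YangMills.Theorems.SusceptibilityToPoincare.RgVarianceCascade

namespace LevelMarginal

variable {G : Type} [Group G] [TopologicalSpace G] [MeasurableSpace G] [BorelSpace G]

/-- The one-level shear `(U, V) ↦ e ↦ V_e · h_e(U)⁻¹` by the straight transporters of the fine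
field (block size `B`, torus of side `2S+1`) is jointly measurable
(`BalabanAveraging.measurable_link`). [folklore] -/
theorem measurable_oneLevelShear [IsTopologicalGroup G] [SecondCountableTopology G] (S B : ℕ)
    [NeZero B] :
    Measurable (Function.uncurry fun (U : GaugeConfig 4 (2 * S + 1) G)
        (V : GaugeConfig 4 (BalabanAveraging.blockSide (2 * S + 1) B) G)
        (e : Edge 4 (BalabanAveraging.blockSide (2 * S + 1) B)) =>
      V e * (BalabanAveraging.link (2 * S + 1) B (BalabanAveraging.BlockMean.rep 0) U e)⁻¹) := by
  refine measurable_pi_lambda _ fun e => ?_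
  have hl := BalabanAveraging.measurable_link (d := 4) (N := 2 * S + 1) (b := B) (G := G)
    (BalabanAveraging.BlockMean.rep 0)
  change Measurable fun ω : GaugeConfig 4 (2 * S + 1) G ×
      GaugeConfig 4 (BalabanAveraging.blockSide (2 * S + 1) B) G =>
    ω.2 e * (BalabanAveraging.link (2 * S + 1) B (BalabanAveraging.BlockMean.rep 0) ω.1 e)⁻¹
  fun_prop

/-- The one-level unshear `(U, W) ↦ e ↦ W_e · h_e(U)` by the straight transporters of the fine
field (block size `B`, torus of side `2S+1`) is jointly measurable. [folklore] -/
theorem measurable_oneLevelUnshear [IsTopologicalGroup G] [SecondCountableTopology G] (S B : ℕ)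
    [NeZero B] :
    Measurable (Function.uncurry fun (U : GaugeConfig 4 (2 * S + 1) G)
        (W : GaugeConfig 4 (BalabanAveraging.blockSide (2 * S + 1) B) G)
        (e : Edge 4 (BalabanAveraging.blockSide (2 * S + 1) B)) =>
      W e * BalabanAveraging.link (2 * S + 1) B (BalabanAveraging.BlockMean.rep 0) U e) := by
  refine measurable_pi_lambda _ fun e => ?_
  have hl := BalabanAveraging.measurable_link (d := 4) (N := 2 * S + 1) (b := B) (G := G)
    (BalabanAveraging.BlockMean.rep 0)
  change Measurable fun ω : GaugeConfig 4 (2 * S + 1) G ×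
      GaugeConfig 4 (BalabanAveraging.blockSide (2 * S + 1) B) G =>
    ω.2 e * BalabanAveraging.link (2 * S + 1) B (BalabanAveraging.BlockMean.rep 0) ω.1 e
  fun_prop

/-- For a fixed fine field `U` the one-level shear `V ↦ e ↦ V_e · h_e(U)⁻¹` preserves the product
Haar measure of the coarse links (right invariance of the Haar probability measure of the compact
group, coordinatewise: `measurePreserving_pi`, `measurePreserving_mul_right`). [folklore] -/
theorem map_oneLevelShear_pi [IsTopologicalGroup G] [CompactSpace G] (S B : ℕ) [NeZero B]
    (U : GaugeConfig 4 (2 * S + 1) G) :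
    (Measure.pi fun _ : Edge 4 (BalabanAveraging.blockSide (2 * S + 1) B) => haarProbability G).map
      (fun (V : GaugeConfig 4 (BalabanAveraging.blockSide (2 * S + 1) B) G)
          (e : Edge 4 (BalabanAveraging.blockSide (2 * S + 1) B)) =>
        V e * (BalabanAveraging.link (2 * S + 1) B (BalabanAveraging.BlockMean.rep 0) U e)⁻¹) =
    Measure.pi fun _ : Edge 4 (BalabanAveraging.blockSide (2 * S + 1) B) => haarProbability G :=
  (measurePreserving_pi (fun _ => haarProbability G) (fun _ => haarProbability G)
    (f := fun (e : Edge 4 (BalabanAveraging.blockSide (2 * S + 1) B)) (x : G) =>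
      x * (BalabanAveraging.link (2 * S + 1) B (BalabanAveraging.BlockMean.rep 0) U e)⁻¹)
    fun _ => measurePreserving_mul_right (haarProbability G) _).map_eq

omit [MeasurableSpace G] [BorelSpace G] in
/-- The one-link sum `W ↦ Σ_i s · Re tr r.ρ (W_i)` on `ι → G` is bounded above by `Σ_i |s| · C`
for any bound `C` on `|Re tr r.ρ|`. [folklore] -/
theorem linkSum_le (r : LatticeRep G) (s : ℝ) {C : ℝ} (hC : ∀ g : G, |((r.ρ g).trace).re| ≤ C)
    {ι : Type*} [Fintype ι] (W : ι → G) :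
    ∑ i, s * (r.ρ (W i)).trace.re ≤ ∑ _i : ι, |s| * C :=
  Finset.sum_le_sum fun i _ => (le_abs_self _).trans (by
    rw [abs_mul]
    exact mul_le_mul_of_nonneg_left (hC _) (abs_nonneg s))

/-- **The level-`k` block of the product Haar measure tilted by the level sum is the level-`k`
product Haar measure tilted by the one-link sum** (family of block tori of sides
`blockSide (2S+1) b^(j+1)`, `j < m + 1`): instance of `FineClauseMono.map_eval_pi_tilted_sum`
(the other levels integrate out). [folklore] -/
theorem map_eval_pi_haar_tilted_levelSum [CompactSpace G] [IsTopologicalGroup G]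
    (r : LatticeRep G) (b m : ℕ) [NeZero b] (s : ℝ) (S : ℕ) (k : Fin (m + 1)) :
    ((Measure.pi fun j : Fin (m + 1) => Measure.pi
        fun _ : Edge 4 (BalabanAveraging.blockSide (2 * S + 1) (b ^ ((j : ℕ) + 1))) =>
          haarProbability G).tilted
        (fun V : (j : Fin (m + 1)) →
            GaugeConfig 4 (BalabanAveraging.blockSide (2 * S + 1) (b ^ ((j : ℕ) + 1))) G =>
          ∑ j : Fin (m + 1),
            ∑ e : Edge 4 (BalabanAveraging.blockSide (2 * S + 1) (b ^ ((j : ℕ) + 1))),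
              s * (r.ρ (V j e)).trace.re)).map (Function.eval k) =
      (Measure.pi fun _ : Edge 4 (BalabanAveraging.blockSide (2 * S + 1) (b ^ ((k : ℕ) + 1))) =>
          haarProbability G).tilted
        fun W : GaugeConfig 4 (BalabanAveraging.blockSide (2 * S + 1) (b ^ ((k : ℕ) + 1))) G =>
          ∑ e : Edge 4 (BalabanAveraging.blockSide (2 * S + 1) (b ^ ((k : ℕ) + 1))),
            s * (r.ρ (W e)).trace.re := by
  obtain ⟨C, -, hC⟩ := exists_bound_trace_re_nonneg r.ρ r.continuous
  exact FineClauseMono.map_eval_pi_tilted_sum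
    (fun j : Fin (m + 1) => Measure.pi
      fun _ : Edge 4 (BalabanAveraging.blockSide (2 * S + 1) (b ^ ((j : ℕ) + 1))) =>
        haarProbability G)
    (φ := fun (j : Fin (m + 1))
        (W : GaugeConfig 4 (BalabanAveraging.blockSide (2 * S + 1) (b ^ ((j : ℕ) + 1))) G) =>
      ∑ e : Edge 4 (BalabanAveraging.blockSide (2 * S + 1) (b ^ ((j : ℕ) + 1))),
        s * (r.ρ (W e)).trace.re)
    (fun j => Finset.measurable_sum _ fun e _ => measurable_const.mul
      ((continuous_trace_re r.ρ r.continuous).measurable.comp (measurable_pi_apply e)))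
    (C := fun j => ∑ _e : Edge 4 (BalabanAveraging.blockSide (2 * S + 1) (b ^ ((j : ℕ) + 1))),
      |s| * C)
    (fun j W => linkSum_le r s hC W) k

end LevelMarginal

/-! ### The registered stub -/

/-- `stub_levelMarginal` — **N2, the (fine field, level-`k` block field) marginal of the `n`-level
joint law is the one-level joint law at block size `b^(k+1)`**.  For EVERY compact `G`, lattice
representation `r`, real `β`, block base `b ≥ 1`, `n`, `s`, side `2S+1` and level `k < n`:
`P.map ((U, V) ↦ (U, V^k)) = (μ_{β,S} ⊗ Haar^{⊗E_k}).tilted (Σ_e s Re tr ρ(V_e (link U e)⁻¹))`.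
Instance of `FineClauseMono.map_prodMap_tilted_prod_shear` with the `n`-level shear
(`JointMarginal.measurable_shear`, `JointMarginal.map_shear_pi`), the one-level shear and unshear
at block size `b^(k+1)` (`LevelMarginal.measurable_oneLevelShear`,
`LevelMarginal.map_oneLevelShear_pi`, `LevelMarginal.measurable_oneLevelUnshear`), the projection
`Function.eval k`, the level sum (`JointMarginal.measurable_levelSum`), the measurable
one-link sum (`continuous_trace_re`) and the level-`k` marginal of the tilted product Haar measure
(`LevelMarginal.map_eval_pi_haar_tilted_levelSum`); `μ_{β,S}` is a probability measure by
`isProbabilityMeasure_wilsonMeasure`. [folklore] -/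
theorem stub_levelMarginal :
    ∀ (G : Type) [Group G] [TopologicalSpace G] [IsTopologicalGroup G] [CompactSpace G]
      [MeasurableSpace G] [BorelSpace G] (r : LatticeRep G) (β : ℝ) (b : ℕ) [NeZero b] (n : ℕ) (s : ℝ) (S : ℕ)
      (P : Measure (GaugeConfig 4 (2 * S + 1) G ×
          ((k : Fin n) → GaugeConfig 4 (BalabanAveraging.blockSide (2 * S + 1) (b ^ ((k : ℕ) + 1))) G))),
      P = ((wilsonMeasure r.ρ β : Measure (GaugeConfig 4 (2 * S + 1) G)).prod
          (Measure.pi fun k : Fin n => Measure.pi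
            fun _ : Edge 4 (BalabanAveraging.blockSide (2 * S + 1) (b ^ ((k : ℕ) + 1))) => haarProbability G)).tilted
          (fun ω => ∑ k : Fin n, ∑ e : Edge 4 (BalabanAveraging.blockSide (2 * S + 1) (b ^ ((k : ℕ) + 1))),
            s * (r.ρ (ω.2 k e * (BalabanAveraging.link (2 * S + 1) (b ^ ((k : ℕ) + 1))
              (BalabanAveraging.BlockMean.rep 0) ω.1 e)⁻¹)).trace.re) →
      ∀ k : Fin n, P.map (fun ω => (ω.1, ω.2 k)) =
        ((wilsonMeasure r.ρ β : Measure (GaugeConfig 4 (2 * S + 1) G)).prod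
          (Measure.pi fun _ : Edge 4 (BalabanAveraging.blockSide (2 * S + 1) (b ^ ((k : ℕ) + 1))) =>
            haarProbability G)).tilted
          (fun ω => ∑ e : Edge 4 (BalabanAveraging.blockSide (2 * S + 1) (b ^ ((k : ℕ) + 1))),
            s * (r.ρ (ω.2 e * (BalabanAveraging.link (2 * S + 1) (b ^ ((k : ℕ) + 1))
              (BalabanAveraging.BlockMean.rep 0) ω.1 e)⁻¹)).trace.re) := by
  intro G _ _ _ _ _ _ r β b _ n s S P hP k
  subst hP
  obtain ⟨m, rfl⟩ : ∃ m, n = m + 1 := ⟨n - 1, by have := k.pos; omega⟩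
  haveI : SecondCountableTopology G :=
    (r.continuous.isClosedEmbedding r.injective).isEmbedding.secondCountableTopology
  haveI := isProbabilityMeasure_wilsonMeasure (d := 4) (L := 2 * S + 1) (G := G) r.ρ r.continuous β
  exact FineClauseMono.map_prodMap_tilted_prod_shear
    (μ := (wilsonMeasure r.ρ β : Measure (GaugeConfig 4 (2 * S + 1) G)))
    (g := fun (U : GaugeConfig 4 (2 * S + 1) G)
        (V : (j : Fin (m + 1)) →
          GaugeConfig 4 (BalabanAveraging.blockSide (2 * S + 1) (b ^ ((j : ℕ) + 1))) G)
        (j : Fin (m + 1)) (e : Edge 4 (BalabanAveraging.blockSide (2 * S + 1) (b ^ ((j : ℕ) + 1)))) =>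
      V j e * (BalabanAveraging.link (2 * S + 1) (b ^ ((j : ℕ) + 1))
        (BalabanAveraging.BlockMean.rep 0) U e)⁻¹)
    (JointMarginal.measurable_shear S b (m + 1)) (JointMarginal.map_shear_pi S b (m + 1))
    (g' := fun (U : GaugeConfig 4 (2 * S + 1) G)
        (V : GaugeConfig 4 (BalabanAveraging.blockSide (2 * S + 1) (b ^ ((k : ℕ) + 1))) G)
        (e : Edge 4 (BalabanAveraging.blockSide (2 * S + 1) (b ^ ((k : ℕ) + 1)))) =>
      V e * (BalabanAveraging.link (2 * S + 1) (b ^ ((k : ℕ) + 1))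
        (BalabanAveraging.BlockMean.rep 0) U e)⁻¹)
    (LevelMarginal.measurable_oneLevelShear S (b ^ ((k : ℕ) + 1)))
    (LevelMarginal.map_oneLevelShear_pi S (b ^ ((k : ℕ) + 1)))
    (gi := fun (U : GaugeConfig 4 (2 * S + 1) G)
        (W : GaugeConfig 4 (BalabanAveraging.blockSide (2 * S + 1) (b ^ ((k : ℕ) + 1))) G)
        (e : Edge 4 (BalabanAveraging.blockSide (2 * S + 1) (b ^ ((k : ℕ) + 1)))) =>
      W e * BalabanAveraging.link (2 * S + 1) (b ^ ((k : ℕ) + 1))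
        (BalabanAveraging.BlockMean.rep 0) U e)
    (LevelMarginal.measurable_oneLevelUnshear S (b ^ ((k : ℕ) + 1)))
    (fun U W => funext fun e => inv_mul_cancel_right _ _)
    (p := Function.eval k) (measurable_pi_apply k) (fun U V => rfl)
    (ψ := fun V : (j : Fin (m + 1)) →
        GaugeConfig 4 (BalabanAveraging.blockSide (2 * S + 1) (b ^ ((j : ℕ) + 1))) G =>
      ∑ j : Fin (m + 1),
        ∑ e : Edge 4 (BalabanAveraging.blockSide (2 * S + 1) (b ^ ((j : ℕ) + 1))),
          s * (r.ρ (V j e)).trace.re)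
    (JointMarginal.measurable_levelSum r b (m + 1) s S)
    (ψ' := fun W : GaugeConfig 4 (BalabanAveraging.blockSide (2 * S + 1) (b ^ ((k : ℕ) + 1))) G =>
      ∑ e : Edge 4 (BalabanAveraging.blockSide (2 * S + 1) (b ^ ((k : ℕ) + 1))),
        s * (r.ρ (W e)).trace.re)
    (Finset.measurable_sum _ fun e _ => measurable_const.mul
      ((continuous_trace_re r.ρ r.continuous).measurable.comp (measurable_pi_apply e)))
    (LevelMarginal.map_eval_pi_haar_tilted_levelSum r b m s S k)

end Summit.QuantumFields.YangMills.Theorems.SusceptibilityToPoincare.RgVarianceCascade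

end
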